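import Literature.Analysis.InnerProduct.LensSpaceGeneratingFunctionResidues
import HarnessLib

/-!
# The double poles of the generating function of a three-dimensional lens space `L(q; 1, p)`: a pole of order two at
# `e(−k)` iff `q ∣ (p + 1)k` or `q ∣ (p − 1)k` (Ikeda–Yamamoto 1979 §4: Lemma 4.4, Corollary 4.5, and Corollary 4.7 under
# the one-sided hypotheses (4.13)–(4.14))

Layer `Literature/Analysis/InnerProduct`, namespace `Literature.Analysis.InnerProduct`; lane `lit-hodgefound`, prover seat
`lit-hodgefound-p06`, generation 45, row g45-#3. THEOREMS only (no definition, no instance, no notation, no named fact).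
Companion of `LensSpaceGeneratingFunctionResidues.lean` (row g45-#1: the SIMPLE poles, Proposition 4.6 and (4.18)).

## Source, verbatim (held text `paper:doi-10-18910-4811`)

A. Ikeda, Y. Yamamoto, *On the spectra of 3-dimensional lens spaces*, Osaka J. Math. **16** (1979) 447–469, §4 (p. 454–456):
"**Lemma 4.4.** Suppose `L(q : p₁)` is isospectral to `L(q : p₂)` and `p₁ ≢ ±1 (mod q)`. Then we have either (4.11)
[`(p₁ + 1, q) = (p₂ + 1, q)` and `(p₁ − 1, q) = (p₂ − 1, q)`] or (4.12) [`(p₁ + 1, q) = (p₂ − 1, q)` and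
`(p₁ − 1, q) = (p₂ + 1, q)`]. Moreover the greatest common divisor `((p₁ − 1, q), (p₁ + 1, q))` is equal to 1 or 2. If `q` is
odd (resp. even), it is necessarily 1 (resp. 2). Proof. … Let `F₁(z)` (resp. `F₂(z)`) be the generating function associated to
the spectrum of `L(q : p₁)` (resp. `L(q : p₂)`). By our assumption and Proposition 3.1, `F₁(z) = F₂(z)`. It is clear that if
`F₁(z)` has a pole of order 2 at `γ^k` (`0 < k < q`), then `k` must satisfy either `(p₁ + 1)k ≡ 0 (mod q)` or
`(p₁ − 1)k ≡ 0 (mod q)`. Conversely, if `k` satisfies either `(p₁ + 1)k ≡ 0 (mod q)` or `(p₁ − 1)k ≡ 0 (mod q)`, then `F₁(z)`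
has a pole of order 2 at `z = γ^k`. In fact, if `k` satisfies `(p₁ + 1)k ≡ 0 (mod q)` (resp. `(p₁ − 1)k ≡ 0 (mod q)`), then
we have `lim_{z→γ^k}(z − γ^k)²F₁(z) = ⋯ (≠ 0)`. … **Corollary 4.5.** Let `L(q : p₁)` and `L(q : p₂)` be as in Lemma 4.4.
Let `k` be an integer such that (4.13) `(p₁ + 1)k ≢ 0 (mod q)` and (4.14) `(p₁ − 1)k ≢ 0 (mod q)`. Then we have (4.15)
`(p₂ + 1)k ≢ 0 (mod q)` and (4.16) `(p₂ − 1)k ≢ 0 (mod q)`." Here (Theorem 3.2, (3.8))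
`F(z) = (1/q)∑_{l=0}^{q−1}(1 − z²)/((1 − γ^{l}z)(1 − γ^{−l}z)(1 − γ^{lp}z)(1 − γ^{−lp}z))`, `γ = e^{2π√−1/q}`.

## The computation, as formalised (`e(t) = e^{2πit/q}`, `z₀ = e(−k)`, `q ∤ 2k`)

If `q ∣ (p + 1)k` or `q ∣ (p − 1)k` (i.e. `kp ≡ ∓k`), the four classes `±k, ±kp*` of the simple-pole computation collapse to
the two classes `±k`, and for `l ≡ ±k` the coefficient multiset `{e(±l), e(±lp)}` is `{e(k), e(k), e(−k), e(−k)}`: the term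
is `(1 − z²)/((1 − e(k)z)²(1 − e(−k)z)²)` up to the order of the factors, and `(1 − e(k)z)²·(term) → (1 − e(−2k))/(1 −
e(−2k))² = 1/(1 − e(−2k))`; no other term has a vanishing factor. Hence `(1 − e(k)z)²F(z) → (2/q)/(1 − e(−2k)) ≠ 0` — a DOUBLE
pole (`tendsto_sq_mul_tsum_lensMultiplicity_of_dvd`). If neither congruence holds, `(1 − e(k)z)²F(z) =
(1 − e(k)z)·[(1 − e(k)z)F(z)] → 0·(2/q)(R(p) + R(p*)) = 0` by Proposition 4.6 (row g45-#1) — at most a simple pole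
(`tendsto_sq_mul_tsum_lensMultiplicity_of_not_dvd`). Two isospectral spaces share `F`, so (LEMMA 4.4, pole-order form) for
every `k` with `q ∤ 2k`: `q ∣ (p₁ + 1)k ∨ q ∣ (p₁ − 1)k ⟺ q ∣ (p₂ + 1)k ∨ q ∣ (p₂ − 1)k`
(`dvd_or_dvd_iff_of_lensMultiplicity_eq`); COROLLARY 4.5 is its contrapositive half (`not_dvd_of_lensMultiplicity_eq`), and
COROLLARY 4.7 then holds under the one-sided hypotheses (4.13)–(4.14) (`cot_alternatingSum_eq_of_lensMultiplicity_eq'`). The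
divisor form of Lemma 4.4 (`dvd_or_dvd_of_dvd_of_lensMultiplicity_eq`): for `d ∣ q` with `d ∤ 2` and `k = q/d`,
`d ∣ p₁ ± 1 ⟹ d ∣ p₂ + 1 ∨ d ∣ p₂ − 1`.

## References

* [IkedaYamamoto1979] A. Ikeda, Y. Yamamoto, *On the spectra of 3-dimensional lens spaces*, Osaka J. Math. 16 (1979) 447–469,
  §4: Lemma 4.4 and its proof, Corollary 4.5, Corollary 4.7, Theorem 3.2 (3.8), Proposition 3.1.
-/

noncomputable section

open Finset Filter Topology Complex

namespace Literature.Analysis.InnerProduct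

open _root_.Real _root_.Filter _root_.Topology

/-! ### §1 Roots of unity and the two limit lemmas (squared factor) -/

/-- `e(a)·e(b) = e(a + b)`. [folklore] -/
private theorem exp_intCast_mul_exp_intCast' (q : ℕ) (a b : ℤ) :
    cexp (2 * π * I * a / q) * cexp (2 * π * I * b / q) = cexp (2 * π * I * ((a + b : ℤ) : ℂ) / q) := by
  rw [← Complex.exp_add]
  congr 1
  push_cast
  ring

/-- `e(a) = 1 ↔ q ∣ a`. [folklore] -/
private theorem exp_intCast_eq_one_iff' {q : ℕ} (hq : q ≠ 0) (a : ℤ) :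
    cexp (2 * π * I * a / q) = 1 ↔ (q : ℤ) ∣ a := by
  have hq0 : (q : ℂ) ≠ 0 := Nat.cast_ne_zero.mpr hq
  have h2 : (2 * π * I : ℂ) ≠ 0 := by simp [Real.pi_ne_zero, I_ne_zero]
  constructor
  · intro h
    obtain ⟨n, hn⟩ := Complex.exp_eq_one_iff.mp h
    have h3 := congrArg (· * (q : ℂ)) hn
    simp only [div_mul_cancel₀ _ hq0] at h3
    have h4 : (2 * π * I) * (a : ℂ) = (2 * π * I) * (n * q) := by linear_combination h3
    have h5 := mul_left_cancel₀ h2 h4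
    exact ⟨n, by exact_mod_cast h5.trans (mul_comm _ _)⟩
  · rintro ⟨c, hc⟩
    rw [hc, show (2 * π * I * ((q * c : ℤ) : ℂ) / q) = c * (2 * π * I) by push_cast; field_simp]
    exact Complex.exp_int_mul_two_pi_mul_I c

/-- `e(a) = 1 ↔ a ≡ 0` in `ℤ/q`. [folklore] -/
private theorem exp_intCast_eq_one_iff_cast' {q : ℕ} (hq : q ≠ 0) (a : ℤ) :
    cexp (2 * π * I * a / q) = 1 ↔ (a : ZMod q) = 0 := by
  rw [exp_intCast_eq_one_iff' hq, ZMod.intCast_zmod_eq_zero_iff_dvd]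

/-- `e(a) = e(b)` when `a ≡ b` in `ℤ/q`. [folklore] -/
private theorem exp_intCast_congr' {q : ℕ} (hq : q ≠ 0) {a b : ℤ} (h : (a : ZMod q) = (b : ZMod q)) :
    cexp (2 * π * I * a / q) = cexp (2 * π * I * b / q) := by
  have hb : cexp (2 * π * I * b / q) ≠ 0 := Complex.exp_ne_zero _
  rw [← div_eq_one_iff_eq hb, ← Complex.exp_sub, show 2 * π * I * (a : ℂ) / q - 2 * π * I * (b : ℂ) / q =
    2 * π * I * ((a - b : ℤ) : ℂ) / q by push_cast; ring, exp_intCast_eq_one_iff_cast' hq, Int.cast_sub, sub_eq_zero]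
  exact h

/-- `|e(a)| = 1`. [folklore] -/
private theorem norm_exp_intCast' (q : ℕ) (a : ℤ) : ‖cexp (2 * π * I * a / q)‖ = 1 := by
  rw [show (2 * π * I * a / q : ℂ) = ((2 * π * a / q : ℝ) : ℂ) * I by push_cast; ring]
  exact Complex.norm_exp_ofReal_mul_I _

/-- The tree's `e^{±2πi·l·p/q}` of (3.8) as `e(t)`, `e(−t)` whenever `lp ≡ t (mod q)`. [folklore] -/
private theorem exp_natCast_mul_eq' {q : ℕ} (hq : q ≠ 0) {l : ℕ} {p t : ℤ} (h : (l : ZMod q) * (p : ZMod q) = (t : ZMod q)) :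
    cexp (2 * π * I * l * p / q) = cexp (2 * π * I * t / q) ∧
      cexp (-(2 * π * I * l * p / q)) = cexp (2 * π * I * ((-t : ℤ) : ℂ) / q) := by
  have h' : (((l : ℤ) * p : ℤ) : ZMod q) = (t : ZMod q) := by rw [Int.cast_mul, Int.cast_natCast, h]
  refine ⟨?_, ?_⟩
  · rw [show cexp (2 * π * I * l * p / q) = cexp (2 * π * I * (((l : ℤ) * p : ℤ) : ℂ) / q) by
      congr 1; push_cast; ring]
    exact exp_intCast_congr' hq h'
  · rw [show cexp (-(2 * π * I * l * p / q)) = cexp (2 * π * I * ((-((l : ℤ) * p) : ℤ) : ℂ) / q) by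
      congr 1; push_cast; ring]
    exact exp_intCast_congr' hq (by rw [Int.cast_neg, Int.cast_neg, h'])

/-- `e^{±2πi·l·p/q}·e(−k) = 1 ↔ ±lp ≡ k (mod q)`. [folklore] -/
private theorem exp_natCast_mul_mul_eq_one_iff' {q : ℕ} (hq : q ≠ 0) (l : ℕ) (p k : ℤ) :
    (cexp (2 * π * I * l * p / q) * cexp (2 * π * I * ((-k : ℤ) : ℂ) / q) = 1 ↔
      (l : ZMod q) * (p : ZMod q) = (k : ZMod q)) ∧
    (cexp (-(2 * π * I * l * p / q)) * cexp (2 * π * I * ((-k : ℤ) : ℂ) / q) = 1 ↔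
      -((l : ZMod q) * (p : ZMod q)) = (k : ZMod q)) := by
  refine ⟨?_, ?_⟩
  · rw [show cexp (2 * π * I * l * p / q) = cexp (2 * π * I * (((l : ℤ) * p : ℤ) : ℂ) / q) by
      congr 1; push_cast; ring, exp_intCast_mul_exp_intCast', exp_intCast_eq_one_iff_cast' hq]
    push_cast
    rw [← sub_eq_add_neg, sub_eq_zero]
  · rw [show cexp (-(2 * π * I * l * p / q)) = cexp (2 * π * I * ((-((l : ℤ) * p) : ℤ) : ℂ) / q) by
      congr 1; push_cast; ring, exp_intCast_mul_exp_intCast', exp_intCast_eq_one_iff_cast' hq]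
    push_cast
    rw [← sub_eq_add_neg, sub_eq_zero]

/-- `pp* ≡ 1 (mod q)` in `ℤ/q`. [folklore] -/
private theorem cast_mul_cast_eq_one''' {q : ℕ} {p u : ℤ} (hu : (q : ℤ) ∣ u * p - 1) :
    (u : ZMod q) * (p : ZMod q) = 1 := by
  have h := (ZMod.intCast_zmod_eq_zero_iff_dvd (u * p - 1) q).mpr hu
  push_cast at h
  exact sub_eq_zero.mp h

/-- `γz₀ = 1`, `z ≠ z₀ ⇒ 1 − γz ≠ 0`. [folklore] -/
private theorem one_sub_mul_ne_zero_of_ne' {γ z₀ z : ℂ} (hγ : γ * z₀ = 1) (hz : z ≠ z₀) : 1 - γ * z ≠ 0 := by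
  intro h
  apply hz
  have hγ0 : γ ≠ 0 := by
    rintro rfl
    simp at hγ
  exact mul_left_cancel₀ hγ0 ((sub_eq_zero.mp h).symm.trans hγ.symm)

/-- **No factor vanishes at `z₀`**: `(1 − γz)²·(1 − z²)/D(z) → 0`. [folklore] -/
private theorem tendsto_sq_mul_div_of_ne_zero' {γ z₀ : ℂ} (hγ : γ * z₀ = 1) {D : ℂ → ℂ} (hD : ContinuousAt D z₀)
    (hD0 : D z₀ ≠ 0) :
    Tendsto (fun z : ℂ ↦ (1 - γ * z) ^ 2 * ((1 - z ^ 2) / D z)) (𝓝[≠] z₀) (𝓝 0) := by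
  have h1 : Tendsto (fun z : ℂ ↦ (1 - γ * z) ^ 2) (𝓝 z₀) (𝓝 ((1 - γ * z₀) ^ 2)) :=
    (tendsto_const_nhds.sub (tendsto_const_nhds.mul tendsto_id)).pow 2
  rw [hγ, sub_self, zero_pow two_ne_zero] at h1
  have h2 : Tendsto (fun z : ℂ ↦ (1 - z ^ 2) / D z) (𝓝 z₀) (𝓝 ((1 - z₀ ^ 2) / D z₀)) :=
    (tendsto_const_nhds.sub (tendsto_id.pow 2)).div hD.tendsto hD0
  have h3 := h1.mul h2
  rw [zero_mul] at h3
  exact h3.mono_left nhdsWithin_le_nhds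

/-- **Exactly two factors vanish at `z₀`** (a double pole of the term): if `D(z) = (1 − γz)(1 − γz)R(z)`, `γz₀ = 1`, `R`
continuous at `z₀` with `R(z₀) ≠ 0`, then `(1 − γz)²·(1 − z²)/D(z) → (1 − z₀²)/R(z₀)`. [folklore] -/
private theorem tendsto_sq_mul_div_of_two' {γ z₀ : ℂ} (hγ : γ * z₀ = 1) {D R : ℂ → ℂ}
    (hDR : ∀ z, D z = (1 - γ * z) * (1 - γ * z) * R z) (hR : ContinuousAt R z₀) (hR0 : R z₀ ≠ 0) :
    Tendsto (fun z : ℂ ↦ (1 - γ * z) ^ 2 * ((1 - z ^ 2) / D z)) (𝓝[≠] z₀) (𝓝 ((1 - z₀ ^ 2) / R z₀)) := by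
  have h2 : Tendsto (fun z : ℂ ↦ (1 - z ^ 2) / R z) (𝓝 z₀) (𝓝 ((1 - z₀ ^ 2) / R z₀)) :=
    (tendsto_const_nhds.sub (tendsto_id.pow 2)).div hR.tendsto hR0
  refine (h2.mono_left nhdsWithin_le_nhds).congr' ?_
  filter_upwards [self_mem_nhdsWithin, mem_nhdsWithin_of_mem_nhds (hR.eventually_ne hR0)] with z hz hRz
  have hz' := one_sub_mul_ne_zero_of_ne' hγ hz
  have hz'' : 1 - z * γ ≠ 0 := by rwa [mul_comm] at hz'
  rw [hDR z]
  field_simp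

/-- **The collapsed term** (`kp ≡ ±k`, `l ≡ ±k`): for `q ∤ 2k`,
`(1 − e(k)z)²·(1 − z²)/((1 − e(k)z)(1 − e(k)z)((1 − e(−k)z)(1 − e(−k)z))) → 1/(1 − e(−2k))` as `z → e(−k)`.
[cite: IkedaYamamoto1979, proof of Lemma 4.4] -/
private theorem tendsto_core_sq {q : ℕ} (hq : q ≠ 0) {k : ℤ} (h2 : ¬ (q : ℤ) ∣ 2 * k) :
    Tendsto (fun z : ℂ ↦ (1 - cexp (2 * π * I * k / q) * z) ^ 2 * ((1 - z ^ 2) /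
      ((1 - cexp (2 * π * I * k / q) * z) * (1 - cexp (2 * π * I * k / q) * z) *
        ((1 - cexp (2 * π * I * ((-k : ℤ) : ℂ) / q) * z) * (1 - cexp (2 * π * I * ((-k : ℤ) : ℂ) / q) * z)))))
      (𝓝[≠] (cexp (2 * π * I * ((-k : ℤ) : ℂ) / q)))
      (𝓝 (1 / (1 - cexp (2 * π * I * ((-(2 * k) : ℤ) : ℂ) / q)))) := by
  have hγ : cexp (2 * π * I * k / q) * cexp (2 * π * I * ((-k : ℤ) : ℂ) / q) = 1 := by
    rw [exp_intCast_mul_exp_intCast', show k + -k = 0 by ring, Int.cast_zero, mul_zero, zero_div, Complex.exp_zero]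
  have hsq : cexp (2 * π * I * ((-k : ℤ) : ℂ) / q) ^ 2 = cexp (2 * π * I * ((-(2 * k) : ℤ) : ℂ) / q) := by
    rw [sq, exp_intCast_mul_exp_intCast', show -k + -k = -(2 * k) by ring]
  have hv1 : cexp (2 * π * I * ((-k : ℤ) : ℂ) / q) * cexp (2 * π * I * ((-k : ℤ) : ℂ) / q) =
      cexp (2 * π * I * ((-(2 * k) : ℤ) : ℂ) / q) := by rw [← sq, hsq]
  have hn1 : 1 - cexp (2 * π * I * ((-(2 * k) : ℤ) : ℂ) / q) ≠ 0 := by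
    rw [sub_ne_zero, ne_comm, Ne, exp_intCast_eq_one_iff' hq, dvd_neg]
    exact h2
  have h := tendsto_sq_mul_div_of_two' hγ
    (D := fun z ↦ (1 - cexp (2 * π * I * k / q) * z) * (1 - cexp (2 * π * I * k / q) * z) *
      ((1 - cexp (2 * π * I * ((-k : ℤ) : ℂ) / q) * z) * (1 - cexp (2 * π * I * ((-k : ℤ) : ℂ) / q) * z)))
    (R := fun z ↦ (1 - cexp (2 * π * I * ((-k : ℤ) : ℂ) / q) * z) * (1 - cexp (2 * π * I * ((-k : ℤ) : ℂ) / q) * z))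
    (fun z ↦ by ring) (by fun_prop) (by
      show (1 - cexp (2 * π * I * ((-k : ℤ) : ℂ) / q) * cexp (2 * π * I * ((-k : ℤ) : ℂ) / q)) *
        (1 - cexp (2 * π * I * ((-k : ℤ) : ℂ) / q) * cexp (2 * π * I * ((-k : ℤ) : ℂ) / q)) ≠ 0
      rw [hv1]
      exact mul_ne_zero hn1 hn1)
  have hval : (1 - cexp (2 * π * I * ((-k : ℤ) : ℂ) / q) ^ 2) /
      ((1 - cexp (2 * π * I * ((-k : ℤ) : ℂ) / q) * cexp (2 * π * I * ((-k : ℤ) : ℂ) / q)) *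
        (1 - cexp (2 * π * I * ((-k : ℤ) : ℂ) / q) * cexp (2 * π * I * ((-k : ℤ) : ℂ) / q))) =
      1 / (1 - cexp (2 * π * I * ((-(2 * k) : ℤ) : ℂ) / q)) := by
    rw [hsq, hv1]
    field_simp
  rw [hval] at h
  exact h

/-! ### §2 The terms of (3.8) in the collapsed configuration `kp ≡ ±k (mod q)` -/

/-- **Case `l ≡ ±k` in the collapsed configuration**: if `κμ = ±κ` in `ℤ/q` (`κ = k`, `μ = p*`), then for `l ≡ k` and for
`l ≡ −k` the term of (3.8), multiplied by `(1 − e(k)z)²`, tends to `1/(1 − e(−2k))`. [cite: IkedaYamamoto1979, proof of Lemma 4.4] -/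
private theorem tendsto_sq_term_special {q : ℕ} (hq : q ≠ 0) {k p u : ℤ} (hu : (q : ℤ) ∣ u * p - 1) (h2 : ¬ (q : ℤ) ∣ 2 * k)
    (hdeg : (k : ZMod q) * (u : ZMod q) = (k : ZMod q) ∨ (k : ZMod q) * (u : ZMod q) = -(k : ZMod q)) {l : ℕ}
    (hl : (l : ZMod q) = (k : ZMod q) ∨ (l : ZMod q) = -(k : ZMod q)) :
    Tendsto (fun z : ℂ ↦ (1 - cexp (2 * π * I * k / q) * z) ^ 2 * ((1 - z ^ 2) /
      ((1 - cexp (2 * π * I * l * ((1 : ℤ) : ℂ) / q) * z) * (1 - cexp (-(2 * π * I * l * ((1 : ℤ) : ℂ) / q)) * z) *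
        ((1 - cexp (2 * π * I * l * (p : ℂ) / q) * z) * (1 - cexp (-(2 * π * I * l * (p : ℂ) / q)) * z)))))
      (𝓝[≠] (cexp (2 * π * I * ((-k : ℤ) : ℂ) / q)))
      (𝓝 (1 / (1 - cexp (2 * π * I * ((-(2 * k) : ℤ) : ℂ) / q)))) := by
  have hup := cast_mul_cast_eq_one''' hu
  -- `κϖ = ±κ` as well (`ϖ = p`)
  have hdeg' : (k : ZMod q) * (p : ZMod q) = (k : ZMod q) ∨ (k : ZMod q) * (p : ZMod q) = -(k : ZMod q) := by
    rcases hdeg with h | h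
    · left; linear_combination (-(p : ZMod q)) * h + (k : ZMod q) * hup
    · right; linear_combination (p : ZMod q) * h - (k : ZMod q) * hup
  -- the four coefficients are `e(±k)` in some order
  rcases hl with hl | hl
  · have h1 : (l : ZMod q) * ((1 : ℤ) : ZMod q) = (k : ZMod q) := by rw [hl]; push_cast; ring
    obtain ⟨e1, e2⟩ := exp_natCast_mul_eq' hq h1
    rcases hdeg' with hd | hd
    · have h3 : (l : ZMod q) * (p : ZMod q) = (k : ZMod q) := by rw [hl, hd]
      obtain ⟨e3, e4⟩ := exp_natCast_mul_eq' hq h3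
      simp only [e1, e2, e3, e4]
      exact (tendsto_core_sq hq h2).congr fun z ↦ by ring
    · have h3 : (l : ZMod q) * (p : ZMod q) = ((-k : ℤ) : ZMod q) := by rw [hl, hd]; push_cast; ring
      obtain ⟨e3, e4⟩ := exp_natCast_mul_eq' hq h3
      simp only [e1, e2, e3, e4, neg_neg]
      exact (tendsto_core_sq hq h2).congr fun z ↦ by ring
  · have h1 : (l : ZMod q) * ((1 : ℤ) : ZMod q) = ((-k : ℤ) : ZMod q) := by rw [hl]; push_cast; ring
    obtain ⟨e1, e2⟩ := exp_natCast_mul_eq' hq h1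
    rcases hdeg' with hd | hd
    · have h3 : (l : ZMod q) * (p : ZMod q) = ((-k : ℤ) : ZMod q) := by
        rw [hl]; push_cast; linear_combination -hd
      obtain ⟨e3, e4⟩ := exp_natCast_mul_eq' hq h3
      simp only [e1, e2, e3, e4, neg_neg]
      exact (tendsto_core_sq hq h2).congr fun z ↦ by ring
    · have h3 : (l : ZMod q) * (p : ZMod q) = (k : ZMod q) := by
        rw [hl]; linear_combination -hd
      obtain ⟨e3, e4⟩ := exp_natCast_mul_eq' hq h3
      simp only [e1, e2, e3, e4, neg_neg]
      exact (tendsto_core_sq hq h2).congr fun z ↦ by ring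

/-- **All other `l` in the collapsed configuration**: no factor vanishes; limit `0`. [cite: IkedaYamamoto1979, proof of Lemma 4.4] -/
private theorem tendsto_sq_term_zero {q : ℕ} (hq : q ≠ 0) {k p u : ℤ} (hu : (q : ℤ) ∣ u * p - 1)
    (hdeg : (k : ZMod q) * (u : ZMod q) = (k : ZMod q) ∨ (k : ZMod q) * (u : ZMod q) = -(k : ZMod q)) {l : ℕ}
    (hA : (l : ZMod q) ≠ (k : ZMod q)) (hB : (l : ZMod q) ≠ -(k : ZMod q)) :
    Tendsto (fun z : ℂ ↦ (1 - cexp (2 * π * I * k / q) * z) ^ 2 * ((1 - z ^ 2) /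
      ((1 - cexp (2 * π * I * l * ((1 : ℤ) : ℂ) / q) * z) * (1 - cexp (-(2 * π * I * l * ((1 : ℤ) : ℂ) / q)) * z) *
        ((1 - cexp (2 * π * I * l * (p : ℂ) / q) * z) * (1 - cexp (-(2 * π * I * l * (p : ℂ) / q)) * z)))))
      (𝓝[≠] (cexp (2 * π * I * ((-k : ℤ) : ℂ) / q))) (𝓝 0) := by
  have hup := cast_mul_cast_eq_one''' hu
  have hγ : cexp (2 * π * I * k / q) * cexp (2 * π * I * ((-k : ℤ) : ℂ) / q) = 1 := by
    rw [exp_intCast_mul_exp_intCast', show k + -k = 0 by ring, Int.cast_zero, mul_zero, zero_div, Complex.exp_zero]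
  obtain ⟨i1, i2⟩ := exp_natCast_mul_mul_eq_one_iff' hq l 1 k
  obtain ⟨i3, i4⟩ := exp_natCast_mul_mul_eq_one_iff' hq l p k
  -- `lϖ = κ ⇒ l = κμ ∈ {±κ}`, `−lϖ = κ ⇒ l = −κμ ∈ {±κ}`
  have hC : (l : ZMod q) * (p : ZMod q) ≠ (k : ZMod q) := by
    intro h
    have hl : (l : ZMod q) = (k : ZMod q) * (u : ZMod q) := by
      linear_combination (u : ZMod q) * h - (l : ZMod q) * hup
    rcases hdeg with hd | hd
    · exact hA (hl.trans hd)
    · exact hB (hl.trans hd)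
  have hD : -((l : ZMod q) * (p : ZMod q)) ≠ (k : ZMod q) := by
    intro h
    have hl : (l : ZMod q) = -((k : ZMod q) * (u : ZMod q)) := by
      linear_combination (-(u : ZMod q)) * h - (l : ZMod q) * hup
    rcases hdeg with hd | hd
    · exact hB (by rw [hl, hd])
    · exact hA (by rw [hl, hd, neg_neg])
  have f1 : 1 - cexp (2 * π * I * l * ((1 : ℤ) : ℂ) / q) * cexp (2 * π * I * ((-k : ℤ) : ℂ) / q) ≠ 0 := by
    rw [sub_ne_zero, ne_comm, Ne, i1]
    push_cast
    exact fun h ↦ hA (by linear_combination h)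
  have f2 : 1 - cexp (-(2 * π * I * l * ((1 : ℤ) : ℂ) / q)) * cexp (2 * π * I * ((-k : ℤ) : ℂ) / q) ≠ 0 := by
    rw [sub_ne_zero, ne_comm, Ne, i2]
    push_cast
    exact fun h ↦ hB (by linear_combination -h)
  have f3 : 1 - cexp (2 * π * I * l * (p : ℂ) / q) * cexp (2 * π * I * ((-k : ℤ) : ℂ) / q) ≠ 0 := by
    rw [sub_ne_zero, ne_comm, Ne, i3]
    exact hC
  have f4 : 1 - cexp (-(2 * π * I * l * (p : ℂ) / q)) * cexp (2 * π * I * ((-k : ℤ) : ℂ) / q) ≠ 0 := by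
    rw [sub_ne_zero, ne_comm, Ne, i4]
    exact hD
  exact tendsto_sq_mul_div_of_ne_zero' hγ (by fun_prop) (mul_ne_zero (mul_ne_zero f1 f2) (mul_ne_zero f3 f4))

/-- The `l`-th term in the collapsed configuration: limit `1/(1 − e(−2k))` on the classes `±k`, `0` elsewhere.
[cite: IkedaYamamoto1979, proof of Lemma 4.4] -/
private theorem tendsto_sq_term {q : ℕ} (hq : q ≠ 0) {k p u : ℤ} (hu : (q : ℤ) ∣ u * p - 1) (h2 : ¬ (q : ℤ) ∣ 2 * k)
    (hdeg : (k : ZMod q) * (u : ZMod q) = (k : ZMod q) ∨ (k : ZMod q) * (u : ZMod q) = -(k : ZMod q)) (l : ℕ) :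
    Tendsto (fun z : ℂ ↦ (1 - cexp (2 * π * I * k / q) * z) ^ 2 * ((1 - z ^ 2) /
      ((1 - cexp (2 * π * I * l * ((1 : ℤ) : ℂ) / q) * z) * (1 - cexp (-(2 * π * I * l * ((1 : ℤ) : ℂ) / q)) * z) *
        ((1 - cexp (2 * π * I * l * (p : ℂ) / q) * z) * (1 - cexp (-(2 * π * I * l * (p : ℂ) / q)) * z)))))
      (𝓝[≠] (cexp (2 * π * I * ((-k : ℤ) : ℂ) / q)))
      (𝓝 (if (l : ZMod q) = (k : ZMod q) ∨ (l : ZMod q) = -(k : ZMod q) then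
        1 / (1 - cexp (2 * π * I * ((-(2 * k) : ℤ) : ℂ) / q)) else 0)) := by
  by_cases hl : (l : ZMod q) = (k : ZMod q) ∨ (l : ZMod q) = -(k : ZMod q)
  · rw [if_pos hl]
    exact tendsto_sq_term_special hq hu h2 hdeg hl
  · rw [if_neg hl]
    rw [not_or] at hl
    exact tendsto_sq_term_zero hq hu hdeg hl.1 hl.2

/-- `∑_{x ∈ ℤ/q} F(x̃) = ∑_{l < q} F(l)`. [folklore] -/
private theorem sum_zmod_val_eq_sum_range'' {M : Type*} [AddCommMonoid M] {q : ℕ} [NeZero q] (F : ℕ → M) :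
    ∑ x : ZMod q, F x.val = ∑ l ∈ range q, F l := by
  refine Finset.sum_nbij ZMod.val (fun x _ ↦ mem_range.2 (ZMod.val_lt x)) ?_ ?_ (fun _ _ ↦ rfl)
  · exact fun x _ y _ h ↦ ZMod.val_injective q h
  · intro n hn
    exact ⟨(n : ZMod q), by simp, ZMod.val_cast_of_lt (mem_range.1 hn)⟩

/-- Summing the limits: exactly the two classes `±k` contribute. [cite: IkedaYamamoto1979, proof of Lemma 4.4] -/
private theorem sum_range_ite_two {q : ℕ} [NeZero q] {k : ℤ} (h2 : ¬ (q : ℤ) ∣ 2 * k) (X : ℂ) :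
    ∑ l ∈ range q, (if (l : ZMod q) = (k : ZMod q) ∨ (l : ZMod q) = -(k : ZMod q) then X else 0) = 2 * X := by
  classical
  have d1 : (k : ZMod q) ≠ -(k : ZMod q) := by
    intro h
    apply h2
    rw [← ZMod.intCast_zmod_eq_zero_iff_dvd]
    push_cast
    linear_combination h
  have hre := sum_zmod_val_eq_sum_range'' (q := q) (fun l : ℕ ↦
    (if (l : ZMod q) = (k : ZMod q) ∨ (l : ZMod q) = -(k : ZMod q) then X else 0))
  simp only [ZMod.natCast_zmod_val] at hre
  rw [← hre]
  have hpt : ∀ x : ZMod q, (if x = (k : ZMod q) ∨ x = -(k : ZMod q) then X else 0) =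
      (if x = (k : ZMod q) then X else 0) + (if x = -(k : ZMod q) then X else 0) := by
    intro x
    by_cases h1 : x = (k : ZMod q)
    · rw [if_pos (Or.inl h1), if_pos h1, if_neg (fun h ↦ d1 (h1.symm.trans h))]; ring
    by_cases h1' : x = -(k : ZMod q)
    · rw [if_pos (Or.inr h1'), if_neg h1, if_pos h1']; ring
    rw [if_neg (not_or.mpr ⟨h1, h1'⟩), if_neg h1, if_neg h1']; ring
  rw [Finset.sum_congr rfl fun x _ ↦ hpt x]
  simp only [Finset.sum_add_distrib, Finset.sum_ite_eq', Finset.mem_univ, if_true]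
  ring

/-- `𝓝[ball 0 1] z₀ ≤ 𝓝[≠] z₀` and `𝓝[ball 0 1] z₀` is nontrivial, for `|z₀| = 1`. [folklore] -/
private theorem nhdsWithin_ball_le_and_neBot'' {z₀ : ℂ} (hz₀ : ‖z₀‖ = 1) :
    𝓝[Metric.ball (0 : ℂ) 1] z₀ ≤ 𝓝[≠] z₀ ∧ (𝓝[Metric.ball (0 : ℂ) 1] z₀).NeBot := by
  refine ⟨nhdsWithin_mono _ fun z hz (h1 : z = z₀) ↦ ?_, mem_closure_iff_nhdsWithin_neBot.mp ?_⟩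
  · rw [h1, mem_ball_zero_iff, hz₀] at hz
    exact lt_irrefl _ hz
  · rw [closure_ball (0 : ℂ) one_ne_zero, Metric.mem_closedBall, dist_zero_right, hz₀]

/-! ### §3 LEMMA 4.4: a double pole at `e(−k)` iff `q ∣ (p + 1)k` or `q ∣ (p − 1)k`; COROLLARY 4.5; COROLLARY 4.7 one-sided -/

/-- **A DOUBLE POLE** ("if `k` satisfies either `(p₁ + 1)k ≡ 0 (mod q)` or `(p₁ − 1)k ≡ 0 (mod q)`, then `F₁(z)` has a
pole of order 2 at `z = γ^k`"): for `L(q; 1, p)`, `pp* ≡ 1`, `q ∤ 2k` and `q ∣ (p + 1)k` or `q ∣ (p − 1)k`,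
`(1 − e(k)z)²·∑_n dim E_{n(n+2)} zⁿ → (2/q)·1/(1 − e(−2k)) (≠ 0)` as `z → e(−k)` inside the unit disc.
[cite: IkedaYamamoto1979, Lemma 4.4 (proof)] -/
theorem tendsto_sq_mul_tsum_lensMultiplicity_of_dvd {q : ℕ} [NeZero q] {k p u : ℤ} (hu : (q : ℤ) ∣ u * p - 1)
    (h2 : ¬ (q : ℤ) ∣ 2 * k) (hdeg : (q : ℤ) ∣ k * (p + 1) ∨ (q : ℤ) ∣ k * (p - 1)) :
    Tendsto (fun z : ℂ ↦ (1 - cexp (2 * π * I * k / q) * z) ^ 2 * ∑' n : ℕ, (lensMultiplicity q 1 p n : ℂ) * z ^ n)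
      (𝓝[Metric.ball 0 1] (cexp (2 * π * I * ((-k : ℤ) : ℂ) / q)))
      (𝓝 (2 / (q : ℂ) * (1 / (1 - cexp (2 * π * I * ((-(2 * k) : ℤ) : ℂ) / q))))) := by
  have hq : q ≠ 0 := NeZero.ne q
  have hup := cast_mul_cast_eq_one''' hu
  -- `κμ = ±κ`
  have hdeg' : (k : ZMod q) * (u : ZMod q) = (k : ZMod q) ∨ (k : ZMod q) * (u : ZMod q) = -(k : ZMod q) := by
    rcases hdeg with hd | hd
    · right
      have h0 := (ZMod.intCast_zmod_eq_zero_iff_dvd _ _).mpr hd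
      push_cast at h0
      linear_combination (u : ZMod q) * h0 - (k : ZMod q) * hup
    · left
      have h0 := (ZMod.intCast_zmod_eq_zero_iff_dvd _ _).mpr hd
      push_cast at h0
      linear_combination (-(u : ZMod q)) * h0 + (k : ZMod q) * hup
  -- the closed form
  have h := tendsto_finsetSum (range q) fun l (_ : l ∈ range q) ↦ tendsto_sq_term hq hu h2 hdeg' l
  rw [sum_range_ite_two h2] at h
  have h' := (h.const_mul (1 / (q : ℂ))).congr (f₂ := fun z : ℂ ↦ (1 - cexp (2 * π * I * k / q) * z) ^ 2 *
      (1 / (q : ℂ) * ∑ l ∈ range q, (1 - z ^ 2) /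
        ((1 - cexp (2 * π * I * l * ((1 : ℤ) : ℂ) / q) * z) * (1 - cexp (-(2 * π * I * l * ((1 : ℤ) : ℂ) / q)) * z) *
          ((1 - cexp (2 * π * I * l * (p : ℂ) / q) * z) * (1 - cexp (-(2 * π * I * l * (p : ℂ) / q)) * z)))))
    fun z ↦ by simp only [Finset.mul_sum]; exact Finset.sum_congr rfl fun l _ ↦ by ring
  rw [show 1 / (q : ℂ) * (2 * (1 / (1 - cexp (2 * π * I * ((-(2 * k) : ℤ) : ℂ) / q)))) =
    2 / (q : ℂ) * (1 / (1 - cexp (2 * π * I * ((-(2 * k) : ℤ) : ℂ) / q))) by ring] at h'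
  -- transfer to the power series inside the disc
  obtain ⟨hle, _⟩ := nhdsWithin_ball_le_and_neBot'' (norm_exp_intCast' q (-k))
  refine (h'.mono_left hle).congr' ?_
  filter_upwards [self_mem_nhdsWithin] with z hz
  rw [tsum_lensMultiplicity_mul_pow q hq 1 p (mem_ball_zero_iff.mp hz)]

/-- **AT MOST A SIMPLE POLE otherwise**: for `q ∤ 2k`, `q ∤ (p + 1)k`, `q ∤ (p − 1)k`,
`(1 − e(k)z)²·∑_n dim E_{n(n+2)} zⁿ → 0` as `z → e(−k)` inside the disc (Proposition 4.6 times the vanishing factor).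
[cite: IkedaYamamoto1979, Lemma 4.4 (proof), Proposition 4.6] -/
theorem tendsto_sq_mul_tsum_lensMultiplicity_of_not_dvd {q : ℕ} [NeZero q] {k p u : ℤ} (hu : (q : ℤ) ∣ u * p - 1)
    (h2 : ¬ (q : ℤ) ∣ 2 * k) (hm : ¬ (q : ℤ) ∣ k * (p - 1)) (hp : ¬ (q : ℤ) ∣ k * (p + 1)) :
    Tendsto (fun z : ℂ ↦ (1 - cexp (2 * π * I * k / q) * z) ^ 2 * ∑' n : ℕ, (lensMultiplicity q 1 p n : ℂ) * z ^ n)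
      (𝓝[Metric.ball 0 1] (cexp (2 * π * I * ((-k : ℤ) : ℂ) / q))) (𝓝 0) := by
  have h1 := tendsto_one_sub_exp_mul_tsum_lensMultiplicity hu h2 hm hp
  have hγ : cexp (2 * π * I * k / q) * cexp (2 * π * I * ((-k : ℤ) : ℂ) / q) = 1 := by
    rw [exp_intCast_mul_exp_intCast', show k + -k = 0 by ring, Int.cast_zero, mul_zero, zero_div, Complex.exp_zero]
  have h0 : Tendsto (fun z : ℂ ↦ 1 - cexp (2 * π * I * k / q) * z) (𝓝[Metric.ball 0 1] (cexp (2 * π * I * ((-k : ℤ) : ℂ) / q)))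
      (𝓝 0) := by
    have h : Tendsto (fun z : ℂ ↦ 1 - cexp (2 * π * I * k / q) * z) (𝓝 (cexp (2 * π * I * ((-k : ℤ) : ℂ) / q)))
        (𝓝 (1 - cexp (2 * π * I * k / q) * cexp (2 * π * I * ((-k : ℤ) : ℂ) / q))) :=
      tendsto_const_nhds.sub (tendsto_const_nhds.mul tendsto_id)
    rw [hγ, sub_self] at h
    exact h.mono_left nhdsWithin_le_nhds
  have h := h0.mul h1
  rw [zero_mul] at h
  refine h.congr fun z ↦ ?_
  ring

/-- **LEMMA 4.4 (Ikeda–Yamamoto 1979), pole-order form.** Let `L(q; 1, p₁)` and `L(q; 1, p₂)` be isospectral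
(`dim E_{n(n+2)}` agree for all `n`), `pᵢpᵢ* ≡ 1 (mod q)`, and let `k` be an integer with `q ∤ 2k`. Then
`q ∣ (p₁ + 1)k ∨ q ∣ (p₁ − 1)k ⟺ q ∣ (p₂ + 1)k ∨ q ∣ (p₂ − 1)k` ("`F₁(z)` has a pole of order 2 at `γ^k` … if and only if
… `(p₁ + 1)k ≡ 0` or `(p₁ − 1)k ≡ 0 (mod q)`", and `F₁ = F₂`). [cite: IkedaYamamoto1979, Lemma 4.4 and its proof,
Proposition 3.1] -/
theorem dvd_or_dvd_iff_of_lensMultiplicity_eq {q : ℕ} [NeZero q] {k p₁ u₁ p₂ u₂ : ℤ} (hu₁ : (q : ℤ) ∣ u₁ * p₁ - 1)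
    (hu₂ : (q : ℤ) ∣ u₂ * p₂ - 1) (h2 : ¬ (q : ℤ) ∣ 2 * k)
    (h : ∀ n : ℕ, lensMultiplicity q 1 p₁ n = lensMultiplicity q 1 p₂ n) :
    ((q : ℤ) ∣ k * (p₁ + 1) ∨ (q : ℤ) ∣ k * (p₁ - 1)) ↔ ((q : ℤ) ∣ k * (p₂ + 1) ∨ (q : ℤ) ∣ k * (p₂ - 1)) := by
  have hq : (q : ℂ) ≠ 0 := Nat.cast_ne_zero.mpr (NeZero.ne q)
  haveI := (nhdsWithin_ball_le_and_neBot'' (norm_exp_intCast' q (-k))).2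
  have hval : 2 / (q : ℂ) * (1 / (1 - cexp (2 * π * I * ((-(2 * k) : ℤ) : ℂ) / q))) ≠ 0 := by
    have hn1 : 1 - cexp (2 * π * I * ((-(2 * k) : ℤ) : ℂ) / q) ≠ 0 := by
      rw [sub_ne_zero, ne_comm, Ne, exp_intCast_eq_one_iff' (NeZero.ne q), dvd_neg]
      exact h2
    exact mul_ne_zero (div_ne_zero two_ne_zero hq) (div_ne_zero one_ne_zero hn1)
  -- a double pole for one weight and a simple pole for the other is impossible, `F₁ = F₂`
  have key : ∀ {a ua b ub : ℤ}, (q : ℤ) ∣ ua * a - 1 → (q : ℤ) ∣ ub * b - 1 →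
      (∀ n : ℕ, lensMultiplicity q 1 a n = lensMultiplicity q 1 b n) →
      ((q : ℤ) ∣ k * (a + 1) ∨ (q : ℤ) ∣ k * (a - 1)) → ((q : ℤ) ∣ k * (b + 1) ∨ (q : ℤ) ∣ k * (b - 1)) := by
    intro a ua b ub hua hub hab hdeg
    by_contra hnot
    rw [not_or] at hnot
    have t1 := tendsto_sq_mul_tsum_lensMultiplicity_of_dvd hua h2 hdeg
    have t2 := tendsto_sq_mul_tsum_lensMultiplicity_of_not_dvd hub h2 hnot.2 hnot.1
    simp only [hab] at t1
    exact hval (tendsto_nhds_unique t1 t2)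
  exact ⟨key hu₁ hu₂ h, key hu₂ hu₁ fun n ↦ (h n).symm⟩

/-- **COROLLARY 4.5 (Ikeda–Yamamoto 1979).** For isospectral `L(q; 1, p₁)`, `L(q; 1, p₂)` (`pᵢpᵢ* ≡ 1`) and `k` with
`q ∤ 2k`: if (4.13) `(p₁ + 1)k ≢ 0` and (4.14) `(p₁ − 1)k ≢ 0 (mod q)`, then (4.15) `(p₂ + 1)k ≢ 0` and (4.16)
`(p₂ − 1)k ≢ 0 (mod q)`. [cite: IkedaYamamoto1979, Corollary 4.5] -/
theorem not_dvd_of_lensMultiplicity_eq {q : ℕ} [NeZero q] {k p₁ u₁ p₂ u₂ : ℤ} (hu₁ : (q : ℤ) ∣ u₁ * p₁ - 1)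
    (hu₂ : (q : ℤ) ∣ u₂ * p₂ - 1) (h2 : ¬ (q : ℤ) ∣ 2 * k) (hp₁ : ¬ (q : ℤ) ∣ k * (p₁ + 1))
    (hm₁ : ¬ (q : ℤ) ∣ k * (p₁ - 1)) (h : ∀ n : ℕ, lensMultiplicity q 1 p₁ n = lensMultiplicity q 1 p₂ n) :
    ¬ (q : ℤ) ∣ k * (p₂ + 1) ∧ ¬ (q : ℤ) ∣ k * (p₂ - 1) := by
  have hiff := dvd_or_dvd_iff_of_lensMultiplicity_eq hu₁ hu₂ h2 h
  have hn : ¬ ((q : ℤ) ∣ k * (p₂ + 1) ∨ (q : ℤ) ∣ k * (p₂ - 1)) := fun h' ↦ (not_or.mpr ⟨hp₁, hm₁⟩) (hiff.mpr h')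
  exact not_or.mp hn

/-- **COROLLARY 4.7 under the one-sided hypotheses (4.13)–(4.14)**: for isospectral `L(q; 1, p₁)`, `L(q; 1, p₂)`,
`pᵢpᵢ* ≡ 1`, and `k` with `q ∤ 2k`, `(p₁ ± 1)k ≢ 0 (mod q)` (Corollary 4.5 supplies `(p₂ ± 1)k ≢ 0`), the relation (4.18):
`cot(π(p₁+1)k/q) − cot(π(p₁−1)k/q) + cot(π(p₁*+1)k/q) − cot(π(p₁*−1)k/q) = ` the same for `p₂`.
[cite: IkedaYamamoto1979, Corollary 4.7 (4.18), Corollary 4.5] -/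
theorem cot_alternatingSum_eq_of_lensMultiplicity_eq' {q : ℕ} [NeZero q] {k p₁ u₁ p₂ u₂ : ℤ}
    (hu₁ : (q : ℤ) ∣ u₁ * p₁ - 1) (hu₂ : (q : ℤ) ∣ u₂ * p₂ - 1) (h2 : ¬ (q : ℤ) ∣ 2 * k)
    (hm₁ : ¬ (q : ℤ) ∣ k * (p₁ - 1)) (hp₁ : ¬ (q : ℤ) ∣ k * (p₁ + 1))
    (h : ∀ n : ℕ, lensMultiplicity q 1 p₁ n = lensMultiplicity q 1 p₂ n) :
    Complex.cot (π * ((k * (p₁ + 1) : ℤ) : ℂ) / q) - Complex.cot (π * ((k * (p₁ - 1) : ℤ) : ℂ) / q) +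
        (Complex.cot (π * ((k * (u₁ + 1) : ℤ) : ℂ) / q) - Complex.cot (π * ((k * (u₁ - 1) : ℤ) : ℂ) / q)) =
      Complex.cot (π * ((k * (p₂ + 1) : ℤ) : ℂ) / q) - Complex.cot (π * ((k * (p₂ - 1) : ℤ) : ℂ) / q) +
        (Complex.cot (π * ((k * (u₂ + 1) : ℤ) : ℂ) / q) - Complex.cot (π * ((k * (u₂ - 1) : ℤ) : ℂ) / q)) := by
  obtain ⟨hp₂, hm₂⟩ := not_dvd_of_lensMultiplicity_eq hu₁ hu₂ h2 hp₁ hm₁ h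
  exact cot_alternatingSum_eq_of_lensMultiplicity_eq hu₁ hu₂ h2 hm₁ hp₁ hm₂ hp₂ h

/-- **LEMMA 4.4, divisor form.** For isospectral `L(q; 1, p₁)`, `L(q; 1, p₂)` (`pᵢpᵢ* ≡ 1`) and a divisor `d` of `q` with
`d ∤ 2` (so that `q ∤ 2(q/d)`): if `d ∣ p₁ + 1` or `d ∣ p₁ − 1` then `d ∣ p₂ + 1` or `d ∣ p₂ − 1` (take `k = q/d` in the
pole-order form: "`d₁` is a divisor of either `d₂ = (p₂ + 1, q)` or `e₂ = (p₂ − 1, q)`"). [cite: IkedaYamamoto1979, Lemma 4.4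
(proof)] -/
theorem dvd_or_dvd_of_dvd_of_lensMultiplicity_eq {q : ℕ} [NeZero q] {p₁ u₁ p₂ u₂ : ℤ} (hu₁ : (q : ℤ) ∣ u₁ * p₁ - 1)
    (hu₂ : (q : ℤ) ∣ u₂ * p₂ - 1) (h : ∀ n : ℕ, lensMultiplicity q 1 p₁ n = lensMultiplicity q 1 p₂ n) {d : ℤ}
    (hd : d ∣ (q : ℤ)) (hd2 : ¬ d ∣ 2) (hdp : d ∣ p₁ + 1 ∨ d ∣ p₁ - 1) : d ∣ p₂ + 1 ∨ d ∣ p₂ - 1 := by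
  obtain ⟨k, hk⟩ := hd
  have hk0 : k ≠ 0 := by
    rintro rfl
    rw [mul_zero] at hk
    exact NeZero.ne q (by exact_mod_cast hk)
  have hconv : ∀ {t : ℤ}, (q : ℤ) ∣ k * t ↔ d ∣ t := by
    intro t
    rw [hk, mul_comm d k]
    exact Int.mul_dvd_mul_iff_left hk0
  have h2 : ¬ (q : ℤ) ∣ 2 * k := by
    rw [mul_comm, hconv]
    exact hd2
  have hiff := dvd_or_dvd_iff_of_lensMultiplicity_eq (k := k) hu₁ hu₂ h2 h
  rw [hconv, hconv, hconv, hconv] at hiff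
  exact hiff.mp hdp

end Literature.Analysis.InnerProduct
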